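import Summits.ResolutionOfSingularities.ResolutionOfSingularities.Theses.FrobeniusLadder
import Summits.ResolutionOfSingularities.ResolutionOfSingularities.Theorems.FrobeniusLadderFInjectiveMacaulayficationRegularPointClause
import Literature.AlgebraicGeometry.Resolution.QuasiProjectiveResolution
import Literature.AlgebraicGeometry.Resolution.QuasiExcellentSchemes
import Literature.AlgebraicGeometry.Resolution.PrincipalizationToResolution
import Literature.AlgebraicGeometry.Resolution.RegularLocusDense
import Literature.AlgebraicGeometry.Resolution.AlterationsMultisectionEtaleNhdChart
import HarnessLib

/-!
# Line U («RESOLVE-THE-STRATA-THEN-FULL-IFY-THE-RESIDUE») for the crux `FrobeniusLadder.FInjectiveMacaulayfication` — DEFINITIONS + PROVED COMPOSITIONS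

[OURS · L1 W4.5a] Theorems-side module of LINE U (registered ALTERNATIVE to door v30): the SORRY-FREE content of res-L1-w45a-strat-1's
`ULine.lean` v1.5 `a49f5b3dbd3e00e6` (text of record, RULING R15.29 (1)), filed by res-L1-w45a-lead-1 per RULING R15.31 (3) so that the U1 hand
(res-L1-w45a-stub-3, `…RegularOffCodimFourResidue`) and the PF_CM hand (res-L1-w45a-stub-2) import ONE module: the statements
`RegularOffCodimFourResidue` (U1), `FullOverCodimFourResidue` (PF), `OneStratumStep`, `CMOverCodimFourResidue` (PF_CM), `FIOverCMResidue` (PF_FI)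
as `def … : Prop`, and the proved compositions / rungs. The four `stub_*` placeholders of the Cruxes-side skeleton are omitted (they are the
open items); nothing else is changed (namespace `…Theorems…` for `…Cruxes…`). Original module text follows.

(res-L1-w45a-strat-1 g6, STRATEGIST line sketch v1.5; OURS, AI-written, weaker than expert review; (skeleton note: `sorry` only inside `stub_*`: v1.5 (FROZEN, plan-1 R15.26) stubs = `stub_regularOffCodimFourResidue` (U1, KNOWN: Temkin 2008 2.3.4 + CP 2019, path R-U1), `stub_cmOverCodimFourResidue` (PF_CM, KNOWN mod Česnavičius), `stub_fiOverCMResidue` (PF_FI, THE OPEN CORE), `stub_fullOverCodimFourResidue` (PF = PF_CM + PF_FI, derived); the v1.2 proper-currency induction `regularOffCodimFourResidue_of_step` is kept as a PROVED variant (superseded by the tree's `temkin2008_prop234_of_comp`).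

THE MOVE. Process the singular strata of `X` TOP-DOWN BY DIMENSION with target **REGULAR** (not FULL) at every stratum whose
local ring has dimension ≤ 3, using the SINGULAR-LOCUS-SUPPORTED desingularisation theorems that exist exactly in those
dimensions — dim 1: normalisation (a blow-up, conductor chart trick / Liu 8.1.24); dim 2: Lipman 1978 (for the 2-dimensional
excellent scheme `Z_x = Bl_J Spec 𝒪_{X,x}`, regular off its closed fibre); dim 3: Cossart–Piltant 2019 base-free
(`exists_isBlowup_isRegular_of_dim_three_of_isQuasiExcellent` applied to the 3-dimensional quasi-excellent `Z_x`, whose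
singular locus lies in the closed fibre because every proper generization of `x` was processed before). Because the target
is REGULAR, (i) the centre at `x` is automatically supported in the closed fibre over `x` (no «F-good but singular generization»
rigidity = no PFN problem, no Theorem-W obstruction: the wild pinch's glued line is a singular stratum and is simply
resolved generically), (ii) the patching is FREE: a seed `x` is modified only along `closure {x}`, goodness elsewhere is read
off stalks of the centre, and the residue after each level is a closed set of strictly smaller dimension. The recursion STOPS
at local rings of dimension ≥ 4. OUTPUT = `RegularOffCodimFourResidue` (U1): ONE proper birational `X₂ → X` that is regular
off the preimage of a closed set `B` of points of codimension ≥ 4 (for `dim X = 4`: finitely many closed points; for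
`dim X ≤ 3`: `B = ∅`, recovering CP/Lipman). U1 is a THEOREM modulo named facts. v1.1 SIMPLIFICATION (PROPER currency —
the crux only asks for a proper birational model, so the stratum modifications need not be blow-ups): ONE tool serves all
three levels, the printed `CossartPiltant2019General` (CP 2019 Thm 1.1: every reduced separated Noetherian quasi-excellent scheme
of dimension ≤ 3 has a resolution that is an isomorphism over exactly its regular locus), applied to `Z_x := X^{(j)} ×_X Spec 𝒪_{X,x}`
(dim ≤ 3, q.e. by `isQuasiExcellent_of_locallyOfFiniteType` → `isQuasiExcellentRing_stalk` → GeneralLU); the local resolution is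
spread to a neighbourhood `V ∋ x` (EGA IV₃ §8: spreading of proper morphisms / isomorphisms of finite presentation), glued with the
identity over `X ∖ closure {x}` (it is an isomorphism over `V ∖ closure {x}` because the singular locus of `Z_x` lies in the closed
fibre), and extended across the lower-dimensional closed set `T := closure {x} ∖ V` as the CLOSURE of the glued piece inside a Nagata
compactification over `X` (tree fact `NagataCompactification`, Stacks 0F41; over `X ∖ T` the glued piece is proper hence closed, so
nothing changes there); `T` joins the residue. No Lipman1978, no Liu 8.1.24, no Stacks081R, no CP principalization are needed in
this currency (they are needed only if one insists on BLOW-UPS, as v1 did). Also used: openness of the regular locus = tree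
`Scheme.isOpen_regularLocus_of_isQuasiExcellent`, image of a closed set under a proper map closed. RUNG (proved below):
`regularOffResidue_of_dim_le_three` = U1 for `topologicalKrullDim X ≤ 3` with `B = ∅`, from `CossartPiltant2019General` +
`Stacks07QW_field`; with `fullOverResidue_of_empty` it re-derives the crux's conclusion in dimension ≤ 3 on line U
(`fim_conclusion_of_dim_le_three`).

THE RESIDUE. `FullOverCodimFourResidue` (PF) = the crux for the special class «`X₂` proper birational over a variety and
REGULAR off the preimage of a closed set of codimension-≥-4 points» (a literal special case of the crux, hence weaker-or-equal;
the natural proof shape is a blow-up CENTRED OVER `B`, fibre by fibre — the fibres are disjoint closed sets, so NO iteration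
and NO termination count is needed). For `dim X = 4` this is PF4 := «a 4-dimensional `X₂`, regular off finitely many
PROPER fibres `G_b` (dim ≤ 3), admits a proper birational FULL model»: the ENTIRE d = 4 difficulty, door-free (no Kawasaki
re-entry, no Datta–Murayama, no FC″, no #4β♭, no tame/wild split). REGRESS REMARK: U1 applied to such an `X₂` returns an
`X₂′` of the same class (new 3-dimensional fibres over finitely many closed points of the old fibres) — the class is closed
under «resolve the strata of the fibre generically», so PF4 needs an invariant that decreases under [stratum round + point
round]; the cell's point engines ((Q) = `FilteredConeFiModel`, towers) are the point rounds. For `dim X ≥ 5` the residue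
`B` is positive-dimensional and continuing the recursion through local rings of dimension ≥ 4 would need LOCAL RESOLUTION
there (target regular at intermediate levels) — no gain beyond d = 4, consistent with `Literature.Barriers…DimensionFourFrontier`.

COMPOSITION `FInjectiveMacaulayfication_of : U1 → PF → crux` is three lines (compose the two proper birational maps:
`IsBirational.comp`, `IsProper` instance for `≫`).
-/

-- single-problem summit: the doubled namespace component is forced
set_option linter.dupNamespace false

open AlgebraicGeometry CategoryTheory Literature.AlgebraicGeometry.Resolution

namespace Summit.ResolutionOfSingularities.ResolutionOfSingularities.Theorems.FInjectiveMacaulayfication.UReduction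

/-- The crux's stalk clause («FULL stalks»: domain ∧ for every s.o.p.-type sequence: weakly regular ∧ Frobenius closed),
verbatim from `FrobeniusLadder.FInjectiveMacaulayfication`. -/
abbrev FullStalks (p : ℕ) (X' : Scheme.{0}) : Prop :=
  ∀ x : X', IsDomain (X'.presheaf.stalk x) ∧ ∀ d : ℕ, ringKrullDim (X'.presheaf.stalk x) = d →
    ∀ s : Fin d → X'.presheaf.stalk x, (Ideal.span (Set.range s)).radical.IsMaximal →
      RingTheory.Sequence.IsWeaklyRegular (X'.presheaf.stalk x) (List.ofFn s) ∧
      ∀ y : X'.presheaf.stalk x, (∃ e : ℕ, y ^ p ^ e ∈ Ideal.span ((fun z : X'.presheaf.stalk x => z ^ p ^ e) ''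
        (Ideal.span (Set.range s) : Set (X'.presheaf.stalk x)))) → y ∈ Ideal.span (Set.range s)

/-- [KNOWN — Temkin 2008 Prop. 2.3.4 at d = 4 + Cossart–Piltant 2019 Thm 1.1; typed here in PROPER currency] **(U1) regular off a
codimension-≥-4 residue.** Every reduced separated finite-type `k`-scheme `X` has a proper birational reduced model `X₂ → X` which is
REGULAR away from the preimage of a closed set `B ⊆ X` all of whose points have local rings of dimension ≥ 4 («desingularization up to
codimension < 4», Temkin 2008 Def. 2.2.6). Proof = Temkin's localization of desingularization (Prop. 2.3.4, proof (iv) ⇒ (i): at a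
maximal bad point `x` of local dimension ≤ 3 resolve the pro-open local scheme `X₂ ×_X Spec 𝒪_{X,x}` by a blow-up with centre over `x`
— here by CP 2019 — extend the centre by closure, blow up, Noetherian induction), whose induction is PROVED in the tree
(`temkin2008_prop234_of_comp`); see the open item U1 (skeleton `stub_regularOffCodimFourResidue`). -/
def RegularOffCodimFourResidue : Prop :=
  ∀ p : ℕ, p.Prime → ∀ (k : Type) [Field k] [CharP k p] (X : Scheme.{0}) (f : X ⟶ Spec (.of k)),
    IsSeparated f → LocallyOfFiniteType f → QuasiCompact f → IsReduced X →
    ∃ (X₂ : Scheme.{0}) (π₂ : X₂ ⟶ X), IsProper π₂ ∧ IsBirational π₂ ∧ IsReduced X₂ ∧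
      ∃ B : Set X, IsClosed B ∧ (∀ b ∈ B, (4 : WithBot ℕ∞) ≤ ringKrullDim (X.presheaf.stalk b)) ∧
        ∀ x₂ : X₂, π₂.base x₂ ∉ B → IsRegularLocalRing (X₂.presheaf.stalk x₂)


/-- [OURS · candidate statement, OPEN — the whole difficulty] **(PF) FULL-ification over a codimension-≥-4 residue.** The crux
for the special class of inputs produced by (U1): `X₂` reduced, proper birational over a reduced separated finite-type
`k`-scheme `X`, and regular off the preimage of a closed set `B` of codimension-≥-4 points, has a proper birational model with
FULL stalks. (A literal special case of the crux. Natural proof shape: a blow-up centred over `B`, one fibre at a time — the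
fibres are disjoint, no iteration. `dim X ≤ 3`: `B = ∅`, `X₃ = X₂` by `RegularPointClause`. `dim X = 4`: PF4 = a 4-fold regular
off finitely many proper fibres of dimension ≤ 3; isolated case `X₂ = X` near `b` ⊇ the (Q)/GDD engine's range and the Ψ-type
points; non-isolated case = `X₂` singular along a proper exceptional configuration.) Why it might fail: it does not fail as a
statement short of the summit failing in dimension 4 — it is OPEN: no invariant is known that decreases under [resolve the
fibre's strata generically (U1 again) + treat the new closed points], cf. `Literature.Barriers.ResolutionOfSingularities.
DimensionFourFrontier`. [candidate statement, OURS] -/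
def FullOverCodimFourResidue : Prop :=
  ∀ p : ℕ, p.Prime → ∀ (k : Type) [Field k] [CharP k p] (X : Scheme.{0}) (f : X ⟶ Spec (.of k)),
    IsSeparated f → LocallyOfFiniteType f → QuasiCompact f → IsReduced X →
    ∀ (X₂ : Scheme.{0}) (π₂ : X₂ ⟶ X), IsProper π₂ → IsBirational π₂ → IsReduced X₂ →
    ∀ B : Set X, IsClosed B → (∀ b ∈ B, (4 : WithBot ℕ∞) ≤ ringKrullDim (X.presheaf.stalk b)) →
      (∀ x₂ : X₂, π₂.base x₂ ∉ B → IsRegularLocalRing (X₂.presheaf.stalk x₂)) →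
      ∃ (X₃ : Scheme.{0}) (π₃ : X₃ ⟶ X₂), IsProper π₃ ∧ IsBirational π₃ ∧ FullStalks p X₃



/-- [OURS · kernel-checked composition] **crux ⇐ (U1) + (PF)**: compose the two proper birational models. -/
theorem FInjectiveMacaulayfication_of (hU : RegularOffCodimFourResidue) (hP : FullOverCodimFourResidue) :
    Summit.ResolutionOfSingularities.ResolutionOfSingularities.Theses.FrobeniusLadder.FInjectiveMacaulayfication := by
  intro p hp k _ _ X f hsep hft hqc hred
  obtain ⟨X₂, π₂, hprop₂, hbir₂, hred₂, B, hBc, hB4, hreg⟩ := hU p hp k X f hsep hft hqc hred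
  obtain ⟨X₃, π₃, hprop₃, hbir₃, hfull⟩ :=
    hP p hp k X f hsep hft hqc hred X₂ π₂ hprop₂ hbir₂ hred₂ B hBc hB4 hreg
  haveI := hprop₂
  haveI := hprop₃
  exact ⟨X₃, π₃ ≫ π₂, inferInstance, IsBirational.comp hbir₃ hbir₂, hfull⟩

/-- [OURS · sanity rung, PROVED] **(PF) holds when the residue is empty** (e.g. `dim X ≤ 3`): a regular `X₂` is its own FULL
model, by `RegularPointClause.fiClause_stalk_of_isRegularLocalRing`. -/
theorem fullOverResidue_of_empty (p : ℕ) [Fact p.Prime] {k : Type} [Field k] [CharP k p]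
    {X X₂ : Scheme.{0}} (f : X ⟶ Spec (.of k)) (π₂ : X₂ ⟶ X)
    (hreg : ∀ x₂ : X₂, IsRegularLocalRing (X₂.presheaf.stalk x₂)) :
    ∃ (X₃ : Scheme.{0}) (π₃ : X₃ ⟶ X₂), IsProper π₃ ∧ IsBirational π₃ ∧ FullStalks p X₃ := by
  refine ⟨X₂, 𝟙 X₂, inferInstance, ?_, fun x => ?_⟩
  · refine ⟨⊤, by simp, ?_, ?_⟩
    · simp
    · exact inferInstance
  · exact Theorems.FInjectiveMacaulayfication.RegularPointClause.fiClause_stalk_of_isRegularLocalRing p (π₂ ≫ f) x (hreg x)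

/-- RUNG (v1.1): U1 in dimension ≤ 3 with EMPTY residue, from the printed Cossart–Piltant theorem and excellence of
finite-type algebras over a field. [cite: CossartPiltant2019, Thm. 1.1] -/
theorem regularOffResidue_of_dim_le_three (hG : CossartPiltant2019General.{0}) (h07 : Stacks07QW_field.{0})
    {k : Type} [Field k] (X : Scheme.{0}) (f : X ⟶ Spec (.of k))
    [IsSeparated f] [LocallyOfFiniteType f] [QuasiCompact f] [IsReduced X]
    (hdim : topologicalKrullDim X ≤ 3) :
    ∃ (X₂ : Scheme.{0}) (π₂ : X₂ ⟶ X), IsProper π₂ ∧ IsBirational π₂ ∧ IsReduced X₂ ∧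
      ∃ B : Set X, IsClosed B ∧ (∀ b ∈ B, (4 : WithBot ℕ∞) ≤ ringKrullDim (X.presheaf.stalk b)) ∧
        ∀ x₂ : X₂, π₂.base x₂ ∉ B → IsRegularLocalRing (X₂.presheaf.stalk x₂) := by
  haveI : X.IsSeparated := Scheme.isSeparated_of_isSeparated_over f
  haveI : IsNoetherian X := Scheme.isNoetherian_of_finiteType_over_field f
  obtain ⟨X', π, hπ, -⟩ := hG X (Scheme.isQuasiExcellent_of_locallyOfFiniteType h07 f) hdim
  exact ⟨X', π, hπ.isProper, hπ.isBirational, Scheme.IsRegular.isReduced hπ.isRegular, ∅, isClosed_empty,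
    fun b hb => hb.elim, fun x₂ _ => hπ.isRegular x₂⟩

/-- RUNG (v1.1): on line U the crux's CONCLUSION in dimension ≤ 3 is U1(≤ 3) followed by the empty-residue case of PF
(`fullOverResidue_of_empty`, i.e. the regular-point clause). [cite: CossartPiltant2019, Thm. 1.1] -/
theorem fim_conclusion_of_dim_le_three (hG : CossartPiltant2019General.{0}) (h07 : Stacks07QW_field.{0})
    (p : ℕ) [Fact p.Prime] {k : Type} [Field k] [CharP k p] (X : Scheme.{0}) (f : X ⟶ Spec (.of k))
    [IsSeparated f] [LocallyOfFiniteType f] [QuasiCompact f] [IsReduced X]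
    (hdim : topologicalKrullDim X ≤ 3) :
    ∃ (X' : Scheme.{0}) (π : X' ⟶ X), IsProper π ∧ IsBirational π ∧ FullStalks p X' := by
  obtain ⟨X₂, π₂, hprop₂, hbir₂, _, hreg'⟩ :
      ∃ (X₂ : Scheme.{0}) (π₂ : X₂ ⟶ X), IsProper π₂ ∧ IsBirational π₂ ∧ IsReduced X₂ ∧
        ∀ x₂ : X₂, IsRegularLocalRing (X₂.presheaf.stalk x₂) := by
    haveI : X.IsSeparated := Scheme.isSeparated_of_isSeparated_over f
    haveI : IsNoetherian X := Scheme.isNoetherian_of_finiteType_over_field f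
    obtain ⟨X', π, hπ, -⟩ := hG X (Scheme.isQuasiExcellent_of_locallyOfFiniteType h07 f) hdim
    exact ⟨X', π, hπ.isProper, hπ.isBirational, Scheme.IsRegular.isReduced hπ.isRegular, hπ.isRegular⟩
  haveI := hprop₂
  obtain ⟨X₃, π₃, hprop₃, hbir₃, hfull⟩ := fullOverResidue_of_empty p f π₂ hreg'
  haveI := hprop₃
  exact ⟨X₃, π₃ ≫ π₂, inferInstance, IsBirational.comp hbir₃ hbir₂, hfull⟩

/-! ## v1.2 (kept as a PROVED VARIANT; superseded by R-U1 = tree `temkin2008_prop234_of_comp`, tri-2 18:27:11Z) — U1 reduced to the ONE-STRATUM STEP by codimension induction (proved)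

`OneStratumStep` is the only geometric content of U1: given a proper birational reduced model `X₂ → X` that is regular off
the preimage of a closed set `R` all of whose points have local dimension `≥ j` (`1 ≤ j ≤ 3`), and a point `x ∈ R` of local
dimension exactly `j`, produce a new proper birational reduced model regular off the preimage of a closed `R' ⊆ R` with
`x ∉ R'` (paper proof: CP 2019 Thm 1.1 at `Z_x = X₂ ×_X Spec 𝒪_{X,x}` — its singular locus lies in the closed fibre because every
proper generization of `x` has local dimension `< j` (`ringKrullDim_stalk_lt_of_specializes`) hence is outside `R` — then spread
(EGA IV §8), glue with the identity off `closure {x}`, extend across `closure {x} ∖ V` by closure in a Nagata compactification;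
`R' := R ∖ V`). The induction `regularOffCodimFourResidue_of_step` is bookkeeping: well-founded induction on the closed set `R`
(`NoetherianSpace X`), three levels, starting from `R₀ := (Reg X)ᶜ` (closed by quasi-excellence = `Stacks07QW_field`; its points have
local dimension `≥ 1` because a reduced `0`-dimensional Noetherian local ring is a field). -/

/-- [OURS · the U1 step, characteristic-free] **ONE-STRATUM STEP.** See the section docstring. -/
def OneStratumStep : Prop :=
  ∀ (k : Type) [Field k] (X : Scheme.{0}) (f : X ⟶ Spec (.of k)),
    IsSeparated f → LocallyOfFiniteType f → QuasiCompact f → IsReduced X →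
    ∀ j : ℕ, 1 ≤ j → j ≤ 3 →
    ∀ (X₂ : Scheme.{0}) (π₂ : X₂ ⟶ X), IsProper π₂ → IsBirational π₂ → IsReduced X₂ →
    ∀ R : Set X, IsClosed R → (∀ r ∈ R, (j : WithBot ℕ∞) ≤ ringKrullDim (X.presheaf.stalk r)) →
      (∀ x₂ : X₂, π₂.base x₂ ∉ R → IsRegularLocalRing (X₂.presheaf.stalk x₂)) →
    ∀ x ∈ R, ringKrullDim (X.presheaf.stalk x) = j →
      ∃ (X₂' : Scheme.{0}) (π₂' : X₂' ⟶ X), IsProper π₂' ∧ IsBirational π₂' ∧ IsReduced X₂' ∧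
        ∃ R' : Set X, R' ⊆ R ∧ IsClosed R' ∧ x ∉ R' ∧
          ∀ x₂' : X₂', π₂'.base x₂' ∉ R' → IsRegularLocalRing (X₂'.presheaf.stalk x₂')

/-- Arithmetic in `WithBot ℕ∞`: `j ≤ d`, `d ≠ j` ⇒ `j + 1 ≤ d`. [folklore] -/
theorem natCast_succ_le_of_le_of_ne {d : WithBot ℕ∞} {j : ℕ} (h : (j : WithBot ℕ∞) ≤ d) (hne : d ≠ (j : WithBot ℕ∞)) :
    ((j + 1 : ℕ) : WithBot ℕ∞) ≤ d := by
  induction d using WithBot.recBotCoe with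
  | bot => exact absurd h (by simp)
  | coe d =>
    induction d using ENat.recTopCoe with
    | top => exact_mod_cast le_top
    | coe m =>
      have h1 : j ≤ m := by exact_mod_cast h
      have h2 : m ≠ j := fun e => hne (by subst e; rfl)
      have h3 : j + 1 ≤ m := by omega
      exact_mod_cast h3

/-- One LEVEL of the codimension induction: clear every point of local dimension exactly `j` from the residue, by
well-founded induction on the closed residue set. [OURS · proved from the step] -/
theorem level_clear (h : OneStratumStep) {k : Type} [Field k] (X : Scheme.{0}) (f : X ⟶ Spec (.of k))
    [IsSeparated f] [LocallyOfFiniteType f] [QuasiCompact f] [IsReduced X] (j : ℕ) (hj1 : 1 ≤ j) (hj3 : j ≤ 3)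
    (R : TopologicalSpace.Closeds X) :
    ∀ (X₂ : Scheme.{0}) (π₂ : X₂ ⟶ X), IsProper π₂ → IsBirational π₂ → IsReduced X₂ →
      (∀ r ∈ (R : Set X), (j : WithBot ℕ∞) ≤ ringKrullDim (X.presheaf.stalk r)) →
      (∀ x₂ : X₂, π₂.base x₂ ∉ (R : Set X) → IsRegularLocalRing (X₂.presheaf.stalk x₂)) →
      ∃ (X₂' : Scheme.{0}) (π₂' : X₂' ⟶ X), IsProper π₂' ∧ IsBirational π₂' ∧ IsReduced X₂' ∧
        ∃ R' : Set X, IsClosed R' ∧ (∀ r ∈ R', ((j + 1 : ℕ) : WithBot ℕ∞) ≤ ringKrullDim (X.presheaf.stalk r)) ∧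
          ∀ x₂' : X₂', π₂'.base x₂' ∉ R' → IsRegularLocalRing (X₂'.presheaf.stalk x₂') := by
  haveI : IsNoetherian X := Scheme.isNoetherian_of_finiteType_over_field f
  induction R using (wellFounded_lt (α := TopologicalSpace.Closeds X)).induction with
  | _ R ih =>
    intro X₂ π₂ hprop hbir hred hdim hreg
    by_cases hx : ∃ x ∈ (R : Set X), ringKrullDim (X.presheaf.stalk x) = j
    · obtain ⟨x, hxR, hxd⟩ := hx
      obtain ⟨X₂', π₂', hprop', hbir', hred', R', hR'R, hR'cl, hxR', hreg'⟩ :=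
        h k X f ‹_› ‹_› ‹_› ‹_› j hj1 hj3 X₂ π₂ hprop hbir hred R R.isClosed hdim hreg x hxR hxd
      have hlt : (⟨R', hR'cl⟩ : TopologicalSpace.Closeds X) < R :=
        SetLike.lt_iff_le_and_exists.mpr ⟨fun r hr => hR'R hr, x, hxR, hxR'⟩
      exact ih ⟨R', hR'cl⟩ hlt X₂' π₂' hprop' hbir' hred' (fun r hr => hdim r (hR'R hr)) hreg'
    · push Not at hx
      exact ⟨X₂, π₂, hprop, hbir, hred, R, R.isClosed,
        fun r hr => natCast_succ_le_of_le_of_ne (hdim r hr) (hx r hr), hreg⟩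

/-- **U1 from the one-stratum step** (modulo `Stacks07QW_field`: finite-type algebras over a field are excellent, used for the
openness of the regular locus). [OURS · proved] -/
theorem regularOffCodimFourResidue_of_step (h07 : Stacks07QW_field.{0}) (h : OneStratumStep) :
    RegularOffCodimFourResidue := by
  intro p hp k _ _ X f hsep hft hqc hred
  haveI := hsep; haveI := hft; haveI := hqc; haveI := hred
  haveI : IsNoetherian X := Scheme.isNoetherian_of_finiteType_over_field f
  have hqe := Scheme.isQuasiExcellent_of_locallyOfFiniteType h07 f
  -- level 0: the non-regular locus, all of whose points have local dimension ≥ 1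
  set R₀ : TopologicalSpace.Closeds X :=
    ⟨(Scheme.regularLocus X)ᶜ, (Scheme.isOpen_regularLocus_of_isQuasiExcellent hqe).isClosed_compl⟩ with hR₀
  have hdim₀ : ∀ r ∈ (R₀ : Set X), ((1 : ℕ) : WithBot ℕ∞) ≤ ringKrullDim (X.presheaf.stalk r) := by
    intro r hr
    have hr' : ¬ IsRegularLocalRing (X.presheaf.stalk r) := hr
    refine natCast_succ_le_of_le_of_ne (j := 0) (by exact_mod_cast ringKrullDim_nonneg_of_nontrivial) ?_
    intro h0
    apply hr'
    have hF : IsField (X.presheaf.stalk r) :=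
      isField_of_isReduced_of_ringKrullDim_eq_zero _ (by exact_mod_cast h0)
    letI := hF.toField
    infer_instance
  have hreg₀ : ∀ x₂ : X, (𝟙 X : X ⟶ X).base x₂ ∉ (R₀ : Set X) → IsRegularLocalRing (X.presheaf.stalk x₂) := by
    intro x₂ hx₂
    have h1 : (𝟙 X : X ⟶ X).base x₂ = x₂ := by simp
    rw [h1] at hx₂
    by_contra hn
    exact hx₂ hn
  have hbir₀ : IsBirational (𝟙 X) := ⟨⊤, by simp, by simp, inferInstance⟩
  obtain ⟨X₁, π₁, hp₁, hb₁, hr₁, R₁, hc₁, hd₁, hg₁⟩ :=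
    level_clear h X f 1 le_rfl (by norm_num) R₀ X (𝟙 X) inferInstance hbir₀ hred hdim₀ hreg₀
  obtain ⟨X₂, π₂, hp₂, hb₂, hr₂, R₂, hc₂, hd₂, hg₂⟩ :=
    level_clear h X f 2 (by norm_num) (by norm_num) ⟨R₁, hc₁⟩ X₁ π₁ hp₁ hb₁ hr₁ hd₁ hg₁
  obtain ⟨X₃, π₃, hp₃, hb₃, hr₃, R₃, hc₃, hd₃, hg₃⟩ :=
    level_clear h X f 3 (by norm_num) le_rfl ⟨R₂, hc₂⟩ X₂ π₂ hp₂ hb₂ hr₂ hd₂ hg₂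
  exact ⟨X₃, π₃, hp₃, hb₃, hr₃, R₃, hc₃, fun b hb => by exact_mod_cast hd₃ b hb, hg₃⟩

/-- [OURS · kernel-checked composition, v1.2 shape] **crux ⇐ (one-stratum step) + (PF)**, modulo `Stacks07QW_field`
(U1 is DERIVED: `regularOffCodimFourResidue_of_step`). -/
theorem FInjectiveMacaulayfication_of_step (h07 : Stacks07QW_field.{0}) (hS : OneStratumStep)
    (hP : FullOverCodimFourResidue) :
    Summit.ResolutionOfSingularities.ResolutionOfSingularities.Theses.FrobeniusLadder.FInjectiveMacaulayfication :=
  FInjectiveMacaulayfication_of (regularOffCodimFourResidue_of_step h07 hS) hP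


/-! ## §6 (v1.4) The residue problem PF split: Macaulayfy first (KNOWN), then F-injectivify a CM input (the CORE)

`FullOverCodimFourResidue ⇐ CMOverCodimFourResidue ∧ FIOverCMResidue` (proved composition below).
PF_CM is KNOWN modulo `Literature.AlgebraicGeometry.Resolution.CesnaviciusMacaulayfication` (Česnavičius 2021 Thm 1.6:
Macaulayfication that is an ISOMORPHISM OVER THE CM LOCUS — so «regular off the residue» survives) + separation of the
irreducible components of the reduced `X₂` (an iso over the locally-integral locus ⊇ the regular locus). PF_FI is the core:
the input may be assumed locally integral, Cohen–Macaulay everywhere and regular off the residue; the output must be FULL. -/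

/-- The Cohen–Macaulay half of the stalk clause (domain ∧ every s.o.p.-type sequence weakly regular). -/
abbrev CMStalks (X' : Scheme.{0}) : Prop :=
  ∀ x : X', IsDomain (X'.presheaf.stalk x) ∧ ∀ d : ℕ, ringKrullDim (X'.presheaf.stalk x) = d →
    ∀ s : Fin d → X'.presheaf.stalk x, (Ideal.span (Set.range s)).radical.IsMaximal →
      RingTheory.Sequence.IsWeaklyRegular (X'.presheaf.stalk x) (List.ofFn s)

/-- [OURS · PF_CM · KNOWN modulo `CesnaviciusMacaulayfication` + component separation, M] **Macaulayfication over the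
residue keeping regularity off it.** -/
def CMOverCodimFourResidue : Prop :=
  ∀ (k : Type) [Field k] (X : Scheme.{0}) (f : X ⟶ Spec (.of k)),
    IsSeparated f → LocallyOfFiniteType f → QuasiCompact f → IsReduced X →
    ∀ (X₂ : Scheme.{0}) (π₂ : X₂ ⟶ X), IsProper π₂ → IsBirational π₂ → IsReduced X₂ →
    ∀ B : Set X, IsClosed B → (∀ b ∈ B, (4 : WithBot ℕ∞) ≤ ringKrullDim (X.presheaf.stalk b)) →
      (∀ x₂ : X₂, π₂.base x₂ ∉ B → IsRegularLocalRing (X₂.presheaf.stalk x₂)) →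
      ∃ (X₃ : Scheme.{0}) (π₃ : X₃ ⟶ X₂), IsProper π₃ ∧ IsBirational π₃ ∧ IsReduced X₃ ∧ CMStalks X₃ ∧
        ∀ x₃ : X₃, π₂.base (π₃.base x₃) ∉ B → IsRegularLocalRing (X₃.presheaf.stalk x₃)


/-- [OURS · PF_FI · the OPEN CORE of line U] **F-injectivification of a Cohen–Macaulay input over the residue.** A reduced,
locally integral, everywhere Cohen–Macaulay proper birational model `X₃ → X` which is regular off the preimage of a closed
set of points of local dimension `≥ 4` admits a proper birational `X₄ → X₃` with FULL stalks. In dimension 4 (= PF4 with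
CM input): the residue is finitely many closed points, the bad locus of `X₃` is a union of proper fibres. Why it might fail:
this is an F-singularity analogue of resolution near a proper fibre of a 4-fold; no decreasing invariant is known
(`Literature.Barriers.ResolutionOfSingularities.DimensionFourFrontier`); CM is not stable under the blow-ups that improve
F-injectivity. [candidate statement, OURS] -/
def FIOverCMResidue : Prop :=
  ∀ p : ℕ, p.Prime → ∀ (k : Type) [Field k] [CharP k p] (X : Scheme.{0}) (f : X ⟶ Spec (.of k)),
    IsSeparated f → LocallyOfFiniteType f → QuasiCompact f → IsReduced X →
    ∀ (X₃ : Scheme.{0}) (π : X₃ ⟶ X), IsProper π → IsBirational π → IsReduced X₃ → CMStalks X₃ →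
    ∀ B : Set X, IsClosed B → (∀ b ∈ B, (4 : WithBot ℕ∞) ≤ ringKrullDim (X.presheaf.stalk b)) →
      (∀ x₃ : X₃, π.base x₃ ∉ B → IsRegularLocalRing (X₃.presheaf.stalk x₃)) →
      ∃ (X₄ : Scheme.{0}) (π₄ : X₄ ⟶ X₃), IsProper π₄ ∧ IsBirational π₄ ∧ FullStalks p X₄


/-- [OURS · PROVED] **PF ⇐ PF_CM + PF_FI.** -/
theorem fullOverCodimFourResidue_of (hCM : CMOverCodimFourResidue) (hFI : FIOverCMResidue) :
    FullOverCodimFourResidue := by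
  intro p hp k _ _ X f hsep hlft hqc hred X₂ π₂ hprop₂ hbir₂ hred₂ B hB hBdim hreg
  obtain ⟨X₃, π₃, hprop₃, hbir₃, hred₃, hcm₃, hreg₃⟩ :=
    hCM k X f hsep hlft hqc hred X₂ π₂ hprop₂ hbir₂ hred₂ B hB hBdim hreg
  haveI := hprop₂
  haveI := hprop₃
  have hreg₃' : ∀ x₃ : X₃, (π₃ ≫ π₂).base x₃ ∉ B → IsRegularLocalRing (X₃.presheaf.stalk x₃) := by
    intro x₃ hx₃
    apply hreg₃
    simpa [Scheme.Hom.comp_base] using hx₃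
  obtain ⟨X₄, π₄, hprop₄, hbir₄, hfull⟩ :=
    hFI p hp k X f hsep hlft hqc hred X₃ (π₃ ≫ π₂) inferInstance (IsBirational.comp hbir₃ hbir₂) hred₃ hcm₃
      B hB hBdim hreg₃'
  haveI := hprop₄
  exact ⟨X₄, π₄ ≫ π₃, inferInstance, IsBirational.comp hbir₄ hbir₃, hfull⟩

/-- [OURS · kernel-checked composition, v1.5 shape] **crux ⇐ U1 + PF_CM + PF_FI**; modulo printed theorems (Temkin 2008 2.3.4,
CP 2019 1.1, Česnavičius 2021 1.6) the only open piece is `FIOverCMResidue`. -/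
theorem FInjectiveMacaulayfication_of_fi (hU : RegularOffCodimFourResidue)
    (hCM : CMOverCodimFourResidue) (hFI : FIOverCMResidue) :
    Summit.ResolutionOfSingularities.ResolutionOfSingularities.Theses.FrobeniusLadder.FInjectiveMacaulayfication :=
  FInjectiveMacaulayfication_of hU (fullOverCodimFourResidue_of hCM hFI)

end Summit.ResolutionOfSingularities.ResolutionOfSingularities.Theorems.FInjectiveMacaulayfication.UReduction
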